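import Mathlib
import Summits.PneNP.PneNP.Theorems.OverlapGapAlgebraSolvableImpliesStableSectionWalkAvoidsBad
import Summits.PneNP.PneNP.Theorems.OverlapGapAlgebraSolvableImpliesStableSectionBadPairsLe
import Summits.PneNP.PneNP.Theorems.OverlapGapAlgebraSolvableImpliesStableSectionGoodWalk
import Summits.PneNP.PneNP.Theorems.OverlapGapAlgebraSolvableImpliesStableSectionLazyWalks
import Summits.PneNP.PneNP.Theorems.OverlapGapAlgebraSolvableImpliesStableSectionPathIsWalk

/-!
# Route OverlapGapAlgebra, crux `SolvableImpliesStableSection` (stmt-PneNP-2463), line `Sketch`: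
# the ENGINE — the crux's path event from typical validity + average stability

`engine_count` (the composition of the registered stubs 1–5 of `Lines/Sketch.lean`): for ANY map
`g : instances → assignments` and ANY set `G` of instances of random `k`-SAT (`m` clauses, `n`
variables, literals `Fin n × Bool`), if `(k m)·#Gᶜ ≤ A·#instances` and the one-slot jumps of `g`
larger than `η n`, counted over (instance, slot, fresh literal), number at most `A·#instances·2n`,
then the number of Bresler–Huang path tuples `Ψ : Fin (k+1) → instances` all of whose `k(mk)+1`
splice points lie in `G` and all of whose consecutive Hamming moves are `≤ η n` is at least
`(2n)^{mk(k+1)}·e^{-4kA·log(2n)} - (2n)^{mk}` — i.e. probability `≥ (2n)^{-4kA} - (2n)^{-k²m}`.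
Mechanism: the splice path is the lazy lexicographic resampling walk (`stub_pathIsWalk`); validity is
folded into the bad-edge relation `Bad v w := v ∉ G ∨ w ∉ G ∨ ηn < d_H(g v, g w)`; the Bresler–Huang
walk lemma (`stub_walkAvoidsBad`, arXiv:2106.02129 Lemma 6.5) lower-bounds the harmless walks by
`|S|^{-Σ_t λ_σ(t)}`; `stub_badPairs_le` bounds the rates, `stub_lazyWalks` removes bad starts,
`stub_goodWalk` reads off the event. No definitions: the walk and the schedule are built inline
(`Nat.rec`, anonymous constructors) and used only through their specifications.
-/

set_option linter.dupNamespace false -- `Summit.PneNP.PneNP.…`: summit = sub-problem (D-0017)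

namespace Summit.PneNP.PneNP.Cruxes.SolvableImpliesStableSection.Sketch

open Finset
open scoped Classical

section Cards

variable (k m n : ℕ)

/-- `#(Fin n × Bool) = 2n` (literals). -/
theorem eng_card_S : Fintype.card (Fin n × Bool) = 2 * n := by
  simp [Fintype.card_prod, mul_comm]

/-- `#(Fin m × Fin k → Fin n × Bool) = (2n)^{mk}` (uncurried instances). -/
theorem eng_card_V : Fintype.card (Fin m × Fin k → Fin n × Bool) = (2 * n) ^ (m * k) := by
  rw [Fintype.card_fun, eng_card_S, Fintype.card_prod, Fintype.card_fin, Fintype.card_fin]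

/-- `#(Fin m → Fin k → Fin n × Bool) = (2n)^{mk}` (instances). -/
theorem eng_card_Inst : Fintype.card (Fin m → Fin k → Fin n × Bool) = (2 * n) ^ (m * k) := by
  rw [Fintype.card_fun, Fintype.card_fun, eng_card_S, Fintype.card_fin, Fintype.card_fin, ← pow_mul,
    Nat.mul_comm k m]

/-- `#(Fin (k+1) → instances) = (2n)^{mk(k+1)}` (path tuples). -/
theorem eng_card_paths :
    Fintype.card (Fin (k + 1) → Fin m → Fin k → Fin n × Bool) = (2 * n) ^ (m * k * (k + 1)) := by
  rw [Fintype.card_fun, eng_card_Inst, Fintype.card_fin, ← pow_mul]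

end Cards

/-- **Engine (stubs 1–5 assembled) at fixed `k, m, n`:** for any map `g` and set `G`, the number of
path tuples all of whose splice points lie in `G` and all of whose consecutive jumps are `≤ η n` is at
least `(2n)^{mk(k+1)} e^{-4kA log(2n)} - (2n)^{mk}`, where `A` bounds the density of `Gᶜ` (times `km`)
and the total one-slot jump mass of `g`. -/
theorem engine_count (k m n : ℕ) (hn : 1 ≤ n) (η A : ℝ) (hη : 0 ≤ η) (hA : 0 ≤ A)
    (g : (Fin m → Fin k → Fin n × Bool) → (Fin n → Bool))
    (G : Finset (Fin m → Fin k → Fin n × Bool))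
    (hG : ((k * m : ℕ) : ℝ) * (Gᶜ.card : ℝ) ≤ A * Fintype.card (Fin m → Fin k → Fin n × Bool))
    (hjump : (∑ a : Fin m, ∑ b : Fin k,
        (((Finset.univ : Finset ((Fin m → Fin k → Fin n × Bool) × (Fin n × Bool))).filter
          fun p => η * n < hammingDist (g p.1)
            (g (Function.update p.1 a (Function.update (p.1 a) b p.2)))).card : ℝ))
      ≤ A * (Fintype.card (Fin m → Fin k → Fin n × Bool) * (2 * n))) :
    (2 * n : ℝ) ^ (m * k * (k + 1)) * Real.exp (-(4 * k * A * Real.log (2 * n))) - (2 * n : ℝ) ^ (m * k)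
      ≤ (((univ : Finset (Fin (k + 1) → Fin m → Fin k → Fin n × Bool)).filter fun Ψ =>
          (∀ r : Fin k, ∀ q ≤ m * k,
            (fun (a : Fin m) (b : Fin k) =>
              if (a : ℕ) * k + b < q then Ψ r.succ a b else Ψ r.castSucc a b) ∈ G) ∧
          ∀ r : Fin k, ∀ q < m * k,
            (hammingDist
              (g fun (a : Fin m) (b : Fin k) =>
                if (a : ℕ) * k + b < q then Ψ r.succ a b else Ψ r.castSucc a b)
              (g fun (a : Fin m) (b : Fin k) =>
                if (a : ℕ) * k + b < q + 1 then Ψ r.succ a b else Ψ r.castSucc a b) : ℝ)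
              ≤ η * n).card : ℝ) := by
  -- the abstract walk (all objects OPAQUE: only their specifications are used below, so that the
  -- `Decidable` instances elaborated here coincide with those of the stub statements)
  set T : ℕ := k * (m * k) with hT
  obtain ⟨σ, hσ⟩ : ∃ σ : Fin T → Fin m × Fin k,
      ∀ t, ((σ t).1 : ℕ) = (t : ℕ) % (m * k) / k ∧ ((σ t).2 : ℕ) = (t : ℕ) % (m * k) % k := by
    have hk : 0 < k ∨ T = 0 := by
      rcases Nat.eq_zero_or_pos k with h | h
      · right; rw [hT, h, zero_mul]
      · left; exact h
    have hmk : 0 < m * k ∨ T = 0 := by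
      rcases Nat.eq_zero_or_pos (m * k) with h | h
      · right; rw [hT, h, mul_zero]
      · left; exact h
    refine ⟨fun t => (⟨(t : ℕ) % (m * k) / k, ?_⟩, ⟨(t : ℕ) % (m * k) % k, ?_⟩), fun t => ⟨rfl, rfl⟩⟩
    · rcases hmk with hmk | hT0
      · rcases hk with hk | hT0
        · exact (Nat.div_lt_iff_lt_mul hk).2 (Nat.mod_lt _ hmk)
        · exact absurd t.isLt (by omega)
      · exact absurd t.isLt (by omega)
    · rcases hk with hk | hT0
      · exact Nat.mod_lt _ hk
      · exact absurd t.isLt (by omega)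
  obtain ⟨pos, hpos0, hposS⟩ : ∃ pos : (Fin m × Fin k → Fin n × Bool) → (Fin T → Fin n × Bool) → ℕ →
      (Fin m × Fin k → Fin n × Bool), (∀ v U, pos v U 0 = v) ∧
        ∀ v U (t : Fin T), pos v U ((t : ℕ) + 1) = Function.update (pos v U t) (σ t) (U t) :=
    ⟨fun v U t => Nat.rec (motive := fun _ => Fin m × Fin k → Fin n × Bool) v
        (fun t w => if h : t < T then Function.update w (σ ⟨t, h⟩) (U ⟨t, h⟩) else w) t,
      fun _ _ => rfl, fun v U t => by simp [t.isLt]⟩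
  obtain ⟨InG, hInG⟩ : ∃ InG : (Fin m × Fin k → Fin n × Bool) → Prop,
      ∀ v, InG v ↔ Function.curry v ∈ G := ⟨_, fun _ => Iff.rfl⟩
  obtain ⟨D, hDiff⟩ : ∃ D : (Fin m × Fin k → Fin n × Bool) → (Fin m × Fin k → Fin n × Bool) → Prop,
      ∀ v w, D v w ↔ η * n < hammingDist (g (Function.curry v)) (g (Function.curry w)) :=
    ⟨_, fun _ _ => Iff.rfl⟩
  obtain ⟨Bad, hBad⟩ : ∃ Bad : (Fin m × Fin k → Fin n × Bool) → (Fin m × Fin k → Fin n × Bool) → Prop,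
      ∀ v w, Bad v w ↔ (¬ InG v ∨ ¬ InG w ∨ D v w) := ⟨_, fun _ _ => Iff.rfl⟩
  have hD : ∀ w, ¬ D w w := fun w h => by
    have h' := (hDiff w w).1 h
    rw [hammingDist_self, Nat.cast_zero] at h'
    have : (0 : ℝ) ≤ η * n := by positivity
    linarith
  have hsymm : ∀ v w, Bad v w → Bad w v := by
    intro v w h
    rcases (hBad v w).1 h with h | h | h
    · exact (hBad w v).2 (Or.inr (Or.inl h))
    · exact (hBad w v).2 (Or.inl h)
    · refine (hBad w v).2 (Or.inr (Or.inr ((hDiff w v).2 ?_)))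
      rw [hammingDist_comm]; exact (hDiff v w).1 h
  have hS : 2 ≤ Fintype.card (Fin n × Bool) := by rw [eng_card_S]; omega
  -- the five f-free stubs
  obtain ⟨hfib, e, he⟩ := stub_pathIsWalk k m n σ hσ pos hpos0 hposS
  have h1 := stub_walkAvoidsBad hS T σ Bad hsymm pos hpos0 hposS
  have h4 := stub_lazyWalks T σ InG D Bad hBad pos hpos0 hposS
  -- harmless walks
  let noBad : (Fin m × Fin k → Fin n × Bool) × (Fin T → Fin n × Bool) → Prop :=
    fun vU => ∀ t : Fin T, vU.2 t = pos vU.1 vU.2 t (σ t) ∨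
      ¬ Bad (pos vU.1 vU.2 t) (pos vU.1 vU.2 ((t : ℕ) + 1))
  have hsplit : ((univ : Finset ((Fin m × Fin k → Fin n × Bool) × (Fin T → Fin n × Bool))).filter
      noBad).card =
      ((univ : Finset ((Fin m × Fin k → Fin n × Bool) × (Fin T → Fin n × Bool))).filter
        fun vU => InG vU.1 ∧ noBad vU).card +
      ((univ : Finset ((Fin m × Fin k → Fin n × Bool) × (Fin T → Fin n × Bool))).filter
        fun vU => ¬ InG vU.1 ∧ noBad vU).card := by
    rw [← Finset.card_filter_add_card_filter_not (s := univ.filter noBad) (fun vU => InG vU.1),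
      Finset.filter_filter, Finset.filter_filter]
    congr 1
    · congr 1; ext vU; simp only [mem_filter, mem_univ, true_and, and_comm]
    · congr 1; ext vU; simp only [mem_filter, mem_univ, true_and, and_comm]
  -- good-start harmless walks inject into good path tuples
  have hinj : ((univ : Finset ((Fin m × Fin k → Fin n × Bool) × (Fin T → Fin n × Bool))).filter
        fun vU => InG vU.1 ∧ noBad vU).card ≤
      ((univ : Finset (Fin (k + 1) → Fin m → Fin k → Fin n × Bool)).filter fun Ψ =>
          (∀ r : Fin k, ∀ q ≤ m * k,
            (fun (a : Fin m) (b : Fin k) =>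
              if (a : ℕ) * k + b < q then Ψ r.succ a b else Ψ r.castSucc a b) ∈ G) ∧
          ∀ r : Fin k, ∀ q < m * k,
            (hammingDist
              (g fun (a : Fin m) (b : Fin k) =>
                if (a : ℕ) * k + b < q then Ψ r.succ a b else Ψ r.castSucc a b)
              (g fun (a : Fin m) (b : Fin k) =>
                if (a : ℕ) * k + b < q + 1 then Ψ r.succ a b else Ψ r.castSucc a b) : ℝ)
              ≤ η * n).card := by
    refine Finset.card_le_card_of_injOn e.symm (fun vU hvU => ?_) e.symm.injective.injOn
    simp only [coe_filter, mem_univ, true_and, Set.mem_setOf_eq] at hvU ⊢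
    obtain ⟨hvG, hno⟩ := hvU
    have hgw := stub_goodWalk T σ InG D Bad hBad hD pos hpos0 hposS vU.1 vU.2 hvG hno
    have heΨ : e (e.symm vU) = vU := e.apply_symm_apply vU
    have hP : ∀ (r : Fin k) (q : ℕ), q ≤ m * k →
        (fun (a : Fin m) (b : Fin k) =>
          if (a : ℕ) * k + b < q then (e.symm vU) r.succ a b else (e.symm vU) r.castSucc a b) =
          Function.curry (pos vU.1 vU.2 ((r : ℕ) * (m * k) + q)) := by
      intro r q hq
      funext a b
      rw [he (e.symm vU) r q hq a b, heΨ]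
      rfl
    have htime : ∀ (r : Fin k) (q : ℕ), q ≤ m * k → (r : ℕ) * (m * k) + q ≤ T := by
      intro r q hq
      calc (r : ℕ) * (m * k) + q ≤ (r : ℕ) * (m * k) + m * k := by omega
        _ = ((r : ℕ) + 1) * (m * k) := by ring
        _ ≤ k * (m * k) := Nat.mul_le_mul_right _ r.isLt
    constructor
    · intro r q hq
      rw [hP r q hq]
      exact (hInG _).1 (hgw.1 _ (htime r q hq))
    · intro r q hq
      rw [hP r q hq.le, hP r (q + 1) hq]
      have hlt : (r : ℕ) * (m * k) + q < T := htime r (q + 1) hq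
      exact not_lt.1 (fun h => hgw.2 _ hlt ((hDiff _ _).2 h))
  -- cardinalities
  have hn0 : (0 : ℝ) < n := by exact_mod_cast hn
  have hn1 : (1 : ℝ) ≤ n := by exact_mod_cast hn
  have hcS : (Fintype.card (Fin n × Bool) : ℝ) = 2 * n := by rw [eng_card_S]; push_cast; ring
  have hcJ : Fintype.card (Fin m × Fin k) = m * k := by simp
  have hcV : (Fintype.card (Fin m × Fin k → Fin n × Bool) : ℝ) = (2 * n) ^ (m * k) := by
    rw [eng_card_V]; push_cast; ring
  have hcI : (Fintype.card (Fin m → Fin k → Fin n × Bool) : ℝ) = (2 * n) ^ (m * k) := by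
    rw [eng_card_Inst]; push_cast; ring
  -- the bad-pair count in direction `j`
  obtain ⟨bp, hbpdef⟩ : ∃ bp : Fin m × Fin k → ℕ, ∀ j, bp j =
      ((univ : Finset ((Fin m × Fin k → Fin n × Bool) × (Fin n × Bool))).filter fun p =>
        p.2 ≠ p.1 j ∧ Bad p.1 (Function.update p.1 j p.2)).card := ⟨_, fun _ => rfl⟩
  -- (a) each slot is resampled exactly `k` times
  have hSumFib : (∑ t : Fin T, (bp (σ t) : ℝ)) = k * ∑ j, (bp j : ℝ) := by
    rw [← Finset.sum_fiberwise' univ σ (fun j => (bp j : ℝ)), Finset.mul_sum]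
    refine Finset.sum_congr rfl fun j _ => ?_
    rw [Finset.sum_const, hfib j, nsmul_eq_mul]
  -- (b) per-direction bound (stub 2), with the complement of `G` and the jump pairs in instance form
  have hnotG : (((univ : Finset (Fin m × Fin k → Fin n × Bool)).filter fun v => ¬ InG v).card : ℝ)
      = Gᶜ.card := by
    congr 1
    refine Finset.card_equiv (Equiv.curry (Fin m) (Fin k) (Fin n × Bool)) fun v => ?_
    simp only [mem_filter, mem_univ, true_and, mem_compl, hInG]
    rfl
  have hjumps : ∀ a b, (((univ : Finset ((Fin m × Fin k → Fin n × Bool) × (Fin n × Bool))).filter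
      fun p => D p.1 (Function.update p.1 (a, b) p.2)).card : ℝ) =
      ((univ : Finset ((Fin m → Fin k → Fin n × Bool) × (Fin n × Bool))).filter
        fun p => η * n < hammingDist (g p.1)
          (g (Function.update p.1 a (Function.update (p.1 a) b p.2)))).card := by
    intro a b
    congr 1
    refine Finset.card_equiv ((Equiv.curry (Fin m) (Fin k) (Fin n × Bool)).prodCongr
      (Equiv.refl _)) fun p => ?_
    simp only [mem_filter, mem_univ, true_and, hDiff, Equiv.prodCongr_apply, Equiv.coe_refl,
      Prod.map_fst, Prod.map_snd, id_eq]
    rw [show Function.curry (Function.update p.1 (a, b) p.2) =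
      Function.update ((Equiv.curry (Fin m) (Fin k) (Fin n × Bool)) p.1) a
        (Function.update ((Equiv.curry (Fin m) (Fin k) (Fin n × Bool)) p.1 a) b p.2) from
      Function.curry_update p.1 (a, b) p.2]
    rfl
  have hbp : ∀ j : Fin m × Fin k, (bp j : ℝ) ≤ 2 * ((2 * n - 1) * Gᶜ.card) +
      ((univ : Finset ((Fin m → Fin k → Fin n × Bool) × (Fin n × Bool))).filter
        fun p => η * n < hammingDist (g p.1)
          (g (Function.update p.1 j.1 (Function.update (p.1 j.1) j.2 p.2)))).card := by
    rintro ⟨a, b⟩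
    have h : bp (a, b) ≤ 2 * ((Fintype.card (Fin n × Bool) - 1) *
        ((univ : Finset (Fin m × Fin k → Fin n × Bool)).filter fun v => ¬ InG v).card) +
        ((univ : Finset ((Fin m × Fin k → Fin n × Bool) × (Fin n × Bool))).filter
          fun p => D p.1 (Function.update p.1 (a, b) p.2)).card := by
      rw [hbpdef]; exact stub_badPairs_le InG D Bad hBad (a, b)
    have h' := (Nat.cast_le (α := ℝ)).2 h
    have hsub : ((Fintype.card (Fin n × Bool) - 1 : ℕ) : ℝ) = 2 * n - 1 := by
      rw [Nat.cast_sub (by rw [eng_card_S]; omega), hcS]; simp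
    push_cast at h'
    rw [hsub, hnotG, hjumps a b] at h'
    exact h'
  -- (c) total: `∑_t bp(σ t) ≤ 4 k A (2n-1) (2n)^{mk}`
  have hGc : ((m * k : ℕ) : ℝ) * (Gᶜ.card : ℝ) ≤ A * (2 * n) ^ (m * k) := by
    calc ((m * k : ℕ) : ℝ) * (Gᶜ.card : ℝ) = ((k * m : ℕ) : ℝ) * (Gᶜ.card : ℝ) := by
          rw [Nat.mul_comm]
      _ ≤ A * Fintype.card (Fin m → Fin k → Fin n × Bool) := hG
      _ = A * (2 * n) ^ (m * k) := by rw [hcI]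
  have hJ' : (∑ j : Fin m × Fin k,
      (((univ : Finset ((Fin m → Fin k → Fin n × Bool) × (Fin n × Bool))).filter
        fun p => η * n < hammingDist (g p.1)
          (g (Function.update p.1 j.1 (Function.update (p.1 j.1) j.2 p.2)))).card : ℝ))
      ≤ A * ((2 * n) ^ (m * k) * (2 * n)) := by
    rw [Fintype.sum_prod_type, ← hcI]; exact hjump
  have hsum : (∑ j : Fin m × Fin k, (bp j : ℝ)) ≤
      (m * k : ℕ) * (2 * ((2 * n - 1) * Gᶜ.card)) + A * ((2 * n) ^ (m * k) * (2 * n)) := by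
    have hstep : (∑ j : Fin m × Fin k, (bp j : ℝ))
        ≤ ∑ j : Fin m × Fin k, (2 * ((2 * n - 1) * (Gᶜ.card : ℝ)) +
            (((univ : Finset ((Fin m → Fin k → Fin n × Bool) × (Fin n × Bool))).filter
              fun p => η * n < hammingDist (g p.1)
                (g (Function.update p.1 j.1 (Function.update (p.1 j.1) j.2 p.2)))).card : ℝ)) :=
      Finset.sum_le_sum fun j _ => hbp j
    rw [Finset.sum_add_distrib, Finset.sum_const, nsmul_eq_mul, Finset.card_univ, hcJ] at hstep
    linarith [hstep, hJ']
  have h2n1 : (0 : ℝ) ≤ 2 * n - 1 := by linarith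
  have hmkG : ((m * k : ℕ) : ℝ) * (2 * ((2 * n - 1) * Gᶜ.card)) ≤
      2 * (2 * n - 1) * (A * (2 * n) ^ (m * k)) := by
    calc ((m * k : ℕ) : ℝ) * (2 * ((2 * n - 1) * Gᶜ.card))
        = 2 * (2 * n - 1) * (((m * k : ℕ) : ℝ) * (Gᶜ.card : ℝ)) := by ring
      _ ≤ 2 * (2 * n - 1) * (A * (2 * n) ^ (m * k)) :=
        mul_le_mul_of_nonneg_left hGc (mul_nonneg (by norm_num) h2n1)
  have htot : (∑ t : Fin T, (bp (σ t) : ℝ)) ≤ 4 * k * A * (2 * n - 1) * (2 * n) ^ (m * k) := by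
    rw [hSumFib]
    have hk0 : (0 : ℝ) ≤ k := Nat.cast_nonneg k
    have hpow : (0 : ℝ) ≤ (2 * n) ^ (m * k) := by positivity
    have hin : (∑ j : Fin m × Fin k, (bp j : ℝ)) ≤ A * (2 * n) ^ (m * k) * (4 * (2 * n - 1)) := by
      have h6 : 2 * (2 * n - 1) * (A * (2 * n) ^ (m * k)) + A * ((2 * n) ^ (m * k) * (2 * n))
          = A * (2 * n) ^ (m * k) * (6 * n - 2) := by ring
      have h7 : A * (2 * n) ^ (m * k) * (6 * n - 2) ≤ A * (2 * n) ^ (m * k) * (4 * (2 * n - 1)) :=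
        mul_le_mul_of_nonneg_left (by linarith) (mul_nonneg hA hpow)
      linarith [hsum, hmkG, h6, h7]
    calc (k : ℝ) * ∑ j : Fin m × Fin k, (bp j : ℝ)
        ≤ k * (A * (2 * n) ^ (m * k) * (4 * (2 * n - 1))) := mul_le_mul_of_nonneg_left hin hk0
      _ = 4 * k * A * (2 * n - 1) * (2 * n) ^ (m * k) := by ring
  -- (d) the exponent of stub 1
  have hexp : Real.exp (-(4 * k * A * Real.log (2 * n))) ≤
      Real.exp (-(Real.log (Fintype.card (Fin n × Bool)) /
        ((Fintype.card (Fin n × Bool) - 1 : ℝ) * (Fintype.card (Fin n × Bool) : ℝ) ^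
          Fintype.card (Fin m × Fin k)) *
        ∑ t : Fin T, (((univ : Finset ((Fin m × Fin k → Fin n × Bool) × (Fin n × Bool))).filter
          fun p => p.2 ≠ p.1 (σ t) ∧ Bad p.1 (Function.update p.1 (σ t) p.2)).card : ℝ))) := by
    have hrw : (∑ t : Fin T, (((univ : Finset ((Fin m × Fin k → Fin n × Bool) × (Fin n × Bool))).filter
          fun p => p.2 ≠ p.1 (σ t) ∧ Bad p.1 (Function.update p.1 (σ t) p.2)).card : ℝ))
        = ∑ t : Fin T, (bp (σ t) : ℝ) := Finset.sum_congr rfl fun t _ => by rw [hbpdef]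
    rw [hrw, Real.exp_le_exp, neg_le_neg_iff, hcS, hcJ]
    have hlog : 0 ≤ Real.log (2 * n) := Real.log_nonneg (by linarith [hn1])
    have hden : (0 : ℝ) < (2 * n - 1) * (2 * n) ^ (m * k) := by
      have : (0 : ℝ) < 2 * n - 1 := by linarith [hn1]
      positivity
    rw [div_mul_eq_mul_div, div_le_iff₀ hden]
    calc Real.log (2 * n) * ∑ t : Fin T, (bp (σ t) : ℝ)
        ≤ Real.log (2 * n) * (4 * k * A * (2 * n - 1) * (2 * n) ^ (m * k)) :=
          mul_le_mul_of_nonneg_left htot hlog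
      _ = 4 * k * A * Real.log (2 * n) * ((2 * n - 1) * (2 * n) ^ (m * k)) := by ring
  -- (e) assemble
  have h1' : (2 * n : ℝ) ^ (m * k * (k + 1)) * Real.exp (-(4 * k * A * Real.log (2 * n))) ≤
      (((univ : Finset ((Fin m × Fin k → Fin n × Bool) × (Fin T → Fin n × Bool))).filter
        noBad).card : ℝ) := by
    refine le_trans ?_ h1
    have hTJ : Fintype.card (Fin m × Fin k) + T = m * k * (k + 1) := by rw [hcJ, hT]; ring
    calc (2 * n : ℝ) ^ (m * k * (k + 1)) * Real.exp (-(4 * k * A * Real.log (2 * n)))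
        = (Fintype.card (Fin n × Bool) : ℝ) ^ (Fintype.card (Fin m × Fin k) + T) *
            Real.exp (-(4 * k * A * Real.log (2 * n))) := by rw [hTJ, hcS]
      _ ≤ _ := mul_le_mul_of_nonneg_left hexp (by positivity)
  have h4n : ((univ : Finset ((Fin m × Fin k → Fin n × Bool) × (Fin T → Fin n × Bool))).filter
      fun vU => ¬ InG vU.1 ∧ noBad vU).card ≤ Fintype.card (Fin m × Fin k → Fin n × Bool) := h4
  have h4' : (((univ : Finset ((Fin m × Fin k → Fin n × Bool) × (Fin T → Fin n × Bool))).filter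
      fun vU => ¬ InG vU.1 ∧ noBad vU).card : ℝ) ≤ (2 * n) ^ (m * k) := by
    rw [← hcV]; exact_mod_cast h4n
  have hsplit' : (((univ : Finset ((Fin m × Fin k → Fin n × Bool) × (Fin T → Fin n × Bool))).filter
      noBad).card : ℝ) =
      (((univ : Finset ((Fin m × Fin k → Fin n × Bool) × (Fin T → Fin n × Bool))).filter
        fun vU => InG vU.1 ∧ noBad vU).card : ℝ) +
      (((univ : Finset ((Fin m × Fin k → Fin n × Bool) × (Fin T → Fin n × Bool))).filter
        fun vU => ¬ InG vU.1 ∧ noBad vU).card : ℝ) := by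
    exact_mod_cast hsplit
  have hinj' := (Nat.cast_le (α := ℝ)).2 hinj
  linarith [h1', h4', hsplit', hinj']

end Summit.PneNP.PneNP.Cruxes.SolvableImpliesStableSection.Sketch
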